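import Literature.Probability.FitznerVanDerHofstad2017.BlockSummation
import HarnessLib

/-!
# [FvdH17] §5.1 / §6.1 (6.5): the split with the CLASS-AVERAGED double-open element — PROVED in abstract form

Source: R. Fitzner, R. van der Hofstad, *Mean-field behavior for nearest-neighbor percolation in `d > 10`*,
Electron. J. Probab. **22** (2017) no. 43 [FvdH17]; page / equation numbers of the extended version
arXiv:1506.07977v2: §5.1 "Elements of the bounds" (p. 49), §6.1 (6.4)–(6.5) (p. 58) and the sentence of §6.1
(p. 59) "When `a = 1` and/or `b = 1`, we include the information that either `u, w` and/or `z, t` are neighbors into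
the definition of `Ā^{ι,a,b}(u,w,z,t)`. … This might look like a small modification, but it allows us to obtain
improved numerical bounds"; the accompanying Mathematica notebook `Percolation.nb` of [FvdH17] (cell 69:
`Bound[AiotaBar,a,1,s] = Bound[Aiota,a,1,s]/(2d z[s])`, `a = 1, 2`) computes the class-1 entries of `Ā^ι` as
AVERAGES over the `2d` unit values of the class-1 offset, where §5.1 prints
`(Ā^ι)_{a,b} = sup_{v,y} Σ_{ι,x} Ā^{ι,a,b}(0,v,x,x+y)` (the tree's `BlockSummation.normOO`, a supremum).

This module is the companion of `BlockSummation` (the tree's kernel-proved form of the summation §6.1 (6.5) /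
§6.2.1: `junction_le`, `tsum_le_of_xSpaceBound`, `tsum_le_vecMul_pow_dotProduct`).  It proves — abstractly, for
kernels with values in `[0, ∞]` on any additive commutative group `G`, length classes in a finite type `ι`,
directions in a finite type `K` — that the same split holds with the AVERAGED double-open element in place of the
supremum, under exactly the two hypotheses that make the average legitimate:

* SUPPORT: for an averaged IN-class `a` the block `Σ_κ Ā^{κ,a,b}(0,v,x,y)` vanishes unless the in-offset `v` lies in
  a fixed finite set `U ⊆ G` (in the paper: class `1` = "`u, w` are neighbors", `U` = the `2d` unit vectors), and
  for an averaged OUT-class `b` it vanishes unless the out-offset `y − x` lies in `U`;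
* FLANK CONSTANCY: the gap aggregate `Λ(v) = Σ_s L(s, s+v)` of the left piece (resp. `Σ_s R(s, s+y)` of the right
  piece) is constant on `U` — for the percolation pieces `P^{S,1}`, `P^{E,1}` this is lattice symmetry
  (`Σ_x P^{E,1}(x, x+u)` is the same for all `2d` unit vectors `u`); the bridge "covariant under a set of additive
  automorphisms acting transitively on `U` ⇒ constant on `U`" is proved here too (`isConstOn_gapSum_of_cov`),
  together with the fact that the recursively built left pieces `P^{(N)}` of (6.48)–(6.49) stay covariant when
  `P^S` and the `κ`-summed closed blocks are (`isCov₂_recP`), so the left flank of every chain (5.34)/(5.37)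
  qualifies.

Mechanism (for `Λ` constant on `U` and ANY `F ≥ 0`): `Σ_{v∈U} Λ(v) F(v) = (Σ_{v∈U} Λ(v)) · |U|⁻¹ Σ_{v∈U} F(v)`
(`sum_mul_eq_sum_mul_avgOn`) — no symmetry whatsoever is asked of `F`, i.e. of the middle block.

Contents (everything kernel-checked; NOTHING here is a cited hypothesis):
* `avgOn U F = |U|⁻¹ Σ_{v∈U} F(v)`, `IsConstOn`, `sum_mul_eq_sum_mul_avgOn`, `tsum_mul_eq_sum_mul_avgOn`,
  `avgOn_le_iSup`;
* `gapSum L v = Σ_s L(s, s+v)`, `openGap M v y = Σ_s M(0,v,s,s+y)`, `pairSum_eq_tsum_gapSum`,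
  `sum_gapSum_le_pairSum`, `gapSum_swap`;
* `junction_eq_gapSum` — the Tonelli/translation-invariance IDENTITY behind (6.5):
  `Σ_x Σ_{u,w,t,z} L(u,w) M(u,w,t,z) R(t−x,z−x) = Σ_{v,y} Λ_L(v) · (Σ_s M(0,v,s,s+y)) · Λ_R(y)`
  (the tree's `junction_le` is this identity followed by `Σ_s M(0,v,s,s+y) ≤ normOO M`);
* `normOOavg U aIn aOut M` — the four shapes of the double-open element: (sup, sup) = `normOO`,
  (sup_v, avg_y), (sup_y, avg_v), (avg_v, avg_y); `normOOavg_le_normOO`;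
* `junction_le_avg` — the split (6.5) with `normOOavg` under SUPPORT + FLANK CONSTANCY for the averaged sides;
* `matAbarAvg U avg A` (entry `(a,b)` averaged on the in-side iff `avg a`, on the out-side iff `avg b`),
  `matAbarAvg_le_matAbar`, and the matrix forms `tsum_le_of_xSpaceBound_avg'` (exit arguments ordered as in (6.4)),
  `tsum_le_of_xSpaceBound_avg` (ordered as in (6.51); needs `−U = U`), `tsum_le_vecMul_matAbarAvg_dotProduct'`,
  `tsum_le_vecMul_pow_dotProduct_avg` (the (5.34)/(5.37) chain with the averaged terminal element);
* the covariance bridge `IsCov₂`, `IsCov₄`, `gapSum_addEquiv`, `isConstOn_gapSum_of_cov`, `isCov₂_recP`,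
  `isConstOn_gapSum_recP`.

Why this is in the tree (package records DIVERGENCE.md D67 / D73, LEMMAS §25 ADDENDUM 5 (L1), numerics seat
num2-g15): for the true percolation letters the supremum-typed entries `(Ā^ι)_{1,1}`, `(Ā^ι)_{2,1}` exceed the
notebook's cells (the cells are the averages), so "element ≤ cell" is provable only for the averaged element; the
averaged element is `≤` the printed supremum (`matAbarAvg_le_matAbar`), hence every bound stated with the printed
element also follows.  The closed elements `(B)_{a,b}`, `(A)_{a,b}` have a single free offset, for which the
supremum over `U` already equals the value at any point of `U` once the `κ`-summed block is covariant — no averaging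
lemma is needed there, and none is stated.  No numerical instantiation, no dimension, no percolation object appears
in this module.
-/

noncomputable section

namespace Literature.Probability.FitznerVanDerHofstad2017.BlockSummation

open scoped ENNReal Matrix

/-! ## Averages over a finite set and orbit constancy -/

section Average

variable {X : Type*}

/-- The average `|U|⁻¹ Σ_{v∈U} F(v)` of `F ≥ 0` over a finite set `U` (value `0` for `U = ∅`): the `1/(2d) Σ_{|u|=1}`
of the notebook's class-1 entries. [cite: FitznerVanDerHofstad2017, §5.1 "Elements of the bounds" (arXiv:1506.07977v2 p. 49) with §6.1 p. 59 "we include the information that … are neighbors"] -/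
def avgOn (U : Finset X) (F : X → ℝ≥0∞) : ℝ≥0∞ := (U.card : ℝ≥0∞)⁻¹ * ∑ v ∈ U, F v

/-- `f` takes one value on the finite set `U` (orbit constancy). [folklore] -/
def IsConstOn (U : Finset X) (f : X → ℝ≥0∞) : Prop := ∀ ⦃v⦄, v ∈ U → ∀ ⦃v'⦄, v' ∈ U → f v = f v'

/-- Unfolding `avgOn`. [folklore] -/
theorem avgOn_def (U : Finset X) (F : X → ℝ≥0∞) :
    avgOn U F = (U.card : ℝ≥0∞)⁻¹ * ∑ v ∈ U, F v := rfl

/-- An average never exceeds the supremum. [folklore] -/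
theorem avgOn_le_iSup (U : Finset X) (F : X → ℝ≥0∞) : avgOn U F ≤ ⨆ v, F v := by
  unfold avgOn
  by_cases hU : U.card = 0
  · rw [Finset.card_eq_zero.mp hU, Finset.sum_empty, mul_zero]
    exact zero_le
  · calc (U.card : ℝ≥0∞)⁻¹ * ∑ v ∈ U, F v
        ≤ (U.card : ℝ≥0∞)⁻¹ * ∑ v ∈ U, ⨆ w, F w :=
          mul_le_mul' le_rfl (Finset.sum_le_sum fun v _ => le_iSup F v)
      _ = ⨆ w, F w := by
          rw [Finset.sum_const, nsmul_eq_mul, ← mul_assoc,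
            ENNReal.inv_mul_cancel (by exact_mod_cast hU) (ENNReal.natCast_ne_top _), one_mul]

/-- Averages are monotone in the integrand on `U`. [folklore] -/
theorem avgOn_mono (U : Finset X) {F F' : X → ℝ≥0∞} (h : ∀ v ∈ U, F v ≤ F' v) :
    avgOn U F ≤ avgOn U F' :=
  mul_le_mul' le_rfl (Finset.sum_le_sum h)

/-- The average of a function vanishing on `U` is `0`. [folklore] -/
theorem avgOn_eq_zero (U : Finset X) {F : X → ℝ≥0∞} (h : ∀ v ∈ U, F v = 0) : avgOn U F = 0 := by
  rw [avgOn, Finset.sum_eq_zero h, mul_zero]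

/-- **Orbit constancy turns a weighted sum into mass × average**: if `Λ` is constant on `U` then, for EVERY `F ≥ 0`,
`Σ_{v∈U} Λ(v) F(v) = (Σ_{v∈U} Λ(v)) · |U|⁻¹ Σ_{v∈U} F(v)`.  (No symmetry is asked of `F`.) [folklore] -/
theorem sum_mul_eq_sum_mul_avgOn (U : Finset X) {Λ : X → ℝ≥0∞} (hΛ : IsConstOn U Λ) (F : X → ℝ≥0∞) :
    ∑ v ∈ U, Λ v * F v = (∑ v ∈ U, Λ v) * avgOn U F := by
  unfold avgOn
  rcases U.eq_empty_or_nonempty with hU | ⟨v₀, hv₀⟩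
  · simp [hU]
  · have hc : ∀ v ∈ U, Λ v = Λ v₀ := fun v hv => hΛ hv hv₀
    have h1 : ∑ v ∈ U, Λ v * F v = Λ v₀ * ∑ v ∈ U, F v := by
      rw [Finset.mul_sum]
      exact Finset.sum_congr rfl fun v hv => by rw [hc v hv]
    have h2 : ∑ v ∈ U, Λ v = (U.card : ℝ≥0∞) * Λ v₀ := by
      rw [Finset.sum_congr rfl hc, Finset.sum_const, nsmul_eq_mul]
    have hcard : (U.card : ℝ≥0∞) ≠ 0 := by
      exact_mod_cast (Finset.card_pos.mpr ⟨v₀, hv₀⟩).ne'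
    rw [h1, h2]
    calc Λ v₀ * ∑ v ∈ U, F v
        = (U.card : ℝ≥0∞) * (U.card : ℝ≥0∞)⁻¹ * (Λ v₀ * ∑ v ∈ U, F v) := by
          rw [ENNReal.mul_inv_cancel hcard (ENNReal.natCast_ne_top _), one_mul]
      _ = (U.card : ℝ≥0∞) * Λ v₀ * ((U.card : ℝ≥0∞)⁻¹ * ∑ v ∈ U, F v) := by ring

/-- The same with an infinite sum whose second factor is SUPPORTED on `U`:
`Σ_v Λ(v) F(v) = (Σ_{v∈U} Λ(v)) · |U|⁻¹ Σ_{v∈U} F(v)`. [folklore] -/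
theorem tsum_mul_eq_sum_mul_avgOn (U : Finset X) {Λ F : X → ℝ≥0∞} (hΛ : IsConstOn U Λ)
    (hF : ∀ v ∉ U, F v = 0) :
    ∑' v, Λ v * F v = (∑ v ∈ U, Λ v) * avgOn U F := by
  rw [tsum_eq_sum (s := U) (fun v hv => by rw [hF v hv, mul_zero])]
  exact sum_mul_eq_sum_mul_avgOn U hΛ F

end Average

/-! ## Gap aggregates and the junction identity -/

section Gap

variable {G : Type*} [AddCommGroup G]

/-- The gap aggregate `Λ_L(v) = Σ_s L(s, s+v)` of a two-point piece: the class-`v` part of `(P⃗)_b = Σ_{x,y} P^b(x,y)`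
("`Σ_{u,w} P^{S,a}(u,u+w)`", "`Σ_{y,x} P^{E,b}(x,x+y)`" in the display (6.5)).
[cite: FitznerVanDerHofstad2017, §6.1 (6.5) (arXiv:1506.07977v2 p. 58)] -/
def gapSum (L : G → G → ℝ≥0∞) (v : G) : ℝ≥0∞ := ∑' s, L s (s + v)

/-- The open gap function of a block at base point `0`: `Σ_s M(0,v,s,s+y)` ("`Σ_{ι,t} Ā^{ι,a,b}(0,w,t,t+y)`" in (6.5)).
[cite: FitznerVanDerHofstad2017, §6.1 (6.5) (arXiv:1506.07977v2 p. 58)] -/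
def openGap (M : G → G → G → G → ℝ≥0∞) (v y : G) : ℝ≥0∞ := ∑' s, M 0 v s (s + y)

/-- `λ(L) = Σ_v Λ_L(v)`. [folklore] -/
theorem pairSum_eq_tsum_gapSum (L : G → G → ℝ≥0∞) : pairSum L = ∑' v, gapSum L v :=
  pairSum_eq_tsum_gap L

/-- A partial gap sum never exceeds `λ(L)`. [folklore] -/
theorem sum_gapSum_le_pairSum (L : G → G → ℝ≥0∞) (U : Finset G) :
    ∑ v ∈ U, gapSum L v ≤ pairSum L := by
  rw [pairSum_eq_tsum_gapSum]
  exact ENNReal.sum_le_tsum U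

/-- `normOO M = sup_{v,y} Σ_s M(0,v,s,s+y)`. [folklore] -/
theorem normOO_eq_iSup_openGap (M : G → G → G → G → ℝ≥0∞) :
    normOO M = ⨆ v, ⨆ y, openGap M v y := rfl

/-- The gap aggregate of the argument-swapped piece is the original one at the opposite gap:
`Σ_s R(s+y, s) = Σ_s R(s, s−y)`. [folklore] -/
theorem gapSum_swap (R : G → G → ℝ≥0∞) (y : G) : gapSum (fun p q => R q p) y = gapSum R (-y) := by
  unfold gapSum
  have h := (tsum_sub_right_eq (fun s => R (s + y) s) y).symm
  simp only [sub_add_cancel] at h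
  simpa only [sub_eq_add_neg] using h

/-- **The junction identity behind (6.5)** (Tonelli + translation invariance, equality form of the tree's
`junction_le`): for a translation-invariant block `M`,
`Σ_x Σ_{u,w,t,z} L(u,w) M(u,w,t,z) R(t−x,z−x) = Σ_{v,y} Λ_L(v) · (Σ_s M(0,v,s,s+y)) · Λ_R(y)` — printed (N = 1):
"`Σ_x Ξ^{(1)}(x) ≤ Σ_{a,b} Σ_{x,u,ι,w,z,t} P^{S,a}(u,w) Ā^{ι,a,b}(u,w,t,z) P^{E,b}(t−x,z−x)
= Σ_{a,b} Σ_{u,w} P^{S,a}(u,u+w) Σ_{y,x} P^{E,b}(x,x+y) Σ_{ι,t} Ā^{ι,a,b}(0,w,t,t+y)`".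
[cite: FitznerVanDerHofstad2017, §6.1 (6.5) (arXiv:1506.07977v2 p. 58)] -/
theorem junction_eq_gapSum (L : G → G → ℝ≥0∞) {M : G → G → G → G → ℝ≥0∞} (hM : IsTransInv M)
    (R : G → G → ℝ≥0∞) :
    ∑' x, ∑' u, ∑' w, ∑' t, ∑' z, L u w * M u w t z * R (t - x) (z - x)
      = ∑' h, ∑' y, gapSum L h * (openGap M h y * gapSum R y) := by
  -- (1) for fixed `x, u, w`: `z = y + t`, then `t = r + x`
  have h1 : ∀ x u w, (∑' t, ∑' z, L u w * M u w t z * R (t - x) (z - x))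
      = ∑' r, ∑' y, L u w * M u w (r + x) (y + r + x) * R r (y + r) := by
    intro x u w
    calc (∑' t, ∑' z, L u w * M u w t z * R (t - x) (z - x))
        = ∑' t, ∑' y, L u w * M u w t (y + t) * R (t - x) (y + t - x) :=
          tsum_congr fun t => (tsum_add_right_eq (fun z => L u w * M u w t z * R (t - x) (z - x)) t).symm
      _ = ∑' r, ∑' y, L u w * M u w (r + x) (y + (r + x)) * R (r + x - x) (y + (r + x) - x) :=
          (tsum_add_right_eq
            (fun t => ∑' y, L u w * M u w t (y + t) * R (t - x) (y + t - x)) x).symm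
      _ = ∑' r, ∑' y, L u w * M u w (r + x) (y + r + x) * R r (y + r) := by
          simp only [← add_assoc, add_sub_cancel_right]
  -- (2) translation invariance moves `x` from `M` into `L`
  have key : ∀ x u w r y, M u w (r + x) (y + r + x) = M (u - x) (w - x) r (y + r) := by
    intro x u w r y
    have := hM x (u - x) (w - x) r (y + r)
    simp only [sub_add_cancel] at this
    exact this
  -- (3) for fixed `x`: `u ↦ u + x`, `w ↦ w + x`
  have h3 : ∀ x, (∑' u, ∑' w, ∑' r, ∑' y, L u w * M (u - x) (w - x) r (y + r) * R r (y + r))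
      = ∑' u, ∑' w, ∑' r, ∑' y, L (u + x) (w + x) * M u w r (y + r) * R r (y + r) := by
    intro x
    calc (∑' u, ∑' w, ∑' r, ∑' y, L u w * M (u - x) (w - x) r (y + r) * R r (y + r))
        = ∑' u, ∑' w, ∑' r, ∑' y, L (u + x) w * M (u + x - x) (w - x) r (y + r) * R r (y + r) :=
          (tsum_add_right_eq
            (fun u => ∑' w, ∑' r, ∑' y, L u w * M (u - x) (w - x) r (y + r) * R r (y + r)) x).symm
      _ = ∑' u, ∑' w, ∑' r, ∑' y,
            L (u + x) (w + x) * M (u + x - x) (w + x - x) r (y + r) * R r (y + r) :=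
          tsum_congr fun u => (tsum_add_right_eq
            (fun w => ∑' r, ∑' y, L (u + x) w * M (u + x - x) (w - x) r (y + r) * R r (y + r)) x).symm
      _ = _ := by simp only [add_sub_cancel_right]
  -- (4) `Σ_x L(u+x, w+x) = Σ_x L(x, x+(w-u))`
  have h4 : ∀ u w, (∑' x, L (u + x) (w + x)) = ∑' x, L x (x + (w - u)) := by
    intro u w
    have e : ∀ x, w + x = u + x + (w - u) := fun x => by abel
    simp only [e]
    exact tsum_add_left_eq (fun v => L v (v + (w - u))) u
  calc ∑' x, ∑' u, ∑' w, ∑' t, ∑' z, L u w * M u w t z * R (t - x) (z - x)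
      = ∑' x, ∑' u, ∑' w, ∑' r, ∑' y, L u w * M (u - x) (w - x) r (y + r) * R r (y + r) := by
        simp only [h1, key]
    _ = ∑' x, ∑' u, ∑' w, ∑' r, ∑' y, L (u + x) (w + x) * M u w r (y + r) * R r (y + r) := by
        simp only [h3]
    _ = ∑' u, ∑' w, ∑' r, ∑' y, ∑' x, L (u + x) (w + x) * M u w r (y + r) * R r (y + r) :=
        tsum_rot₅ _
    _ = ∑' u, ∑' w, ∑' r, ∑' y, (∑' x, L x (x + (w - u))) * (M u w r (y + r) * R r (y + r)) := by
        simp only [mul_assoc, ENNReal.tsum_mul_right, h4]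
    -- (5) `w ↦ h + u`
    _ = ∑' u, ∑' h, ∑' r, ∑' y, (∑' x, L x (x + h)) * (M u (h + u) r (y + r) * R r (y + r)) := by
        refine tsum_congr fun u => ?_
        have := tsum_add_right_eq
          (fun w => ∑' r, ∑' y, (∑' x, L x (x + (w - u))) * (M u w r (y + r) * R r (y + r))) u
        simp only [add_sub_cancel_right] at this
        exact this.symm
    -- (6) `r ↦ s + u` and translation invariance takes `u` out of `M`
    _ = ∑' u, ∑' h, ∑' s, ∑' y, (∑' x, L x (x + h)) * (M 0 h s (s + y) * R (s + u) (s + u + y)) := by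
        refine tsum_congr fun u => tsum_congr fun h => ?_
        have key2 : ∀ s y, M u (h + u) (s + u) (y + (s + u)) = M 0 h s (s + y) := by
          intro s y
          have := hM u 0 h s (s + y)
          simp only [zero_add] at this
          rw [show y + (s + u) = s + y + u by abel]
          exact this
        have e2 : ∀ s y, y + (s + u) = s + u + y := fun s y => by abel
        calc (∑' r, ∑' y, (∑' x, L x (x + h)) * (M u (h + u) r (y + r) * R r (y + r)))
            = ∑' s, ∑' y, (∑' x, L x (x + h)) *
                (M u (h + u) (s + u) (y + (s + u)) * R (s + u) (y + (s + u))) :=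
              (tsum_add_right_eq
                (fun r => ∑' y, (∑' x, L x (x + h)) * (M u (h + u) r (y + r) * R r (y + r))) u).symm
          _ = _ := by simp only [key2]; simp only [e2]
    -- (7) `u` innermost; `Σ_u R(s+u, s+u+y) = Σ_v R(v, v+y)`
    _ = ∑' h, ∑' s, ∑' y, ∑' u, (∑' x, L x (x + h)) * (M 0 h s (s + y) * R (s + u) (s + u + y)) :=
        tsum_rot₄ _
    _ = ∑' h, ∑' s, ∑' y, (∑' x, L x (x + h)) * (M 0 h s (s + y) * ∑' v, R v (v + y)) := by
        have e3 : ∀ s y, (∑' u, R (s + u) (s + u + y)) = ∑' v, R v (v + y) :=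
          fun s y => tsum_add_left_eq (fun v => R v (v + y)) s
        simp only [ENNReal.tsum_mul_left, e3]
    -- (8) swap `s, y` and factor
    _ = ∑' h, ∑' y, (∑' x, L x (x + h)) * ((∑' s, M 0 h s (s + y)) * ∑' v, R v (v + y)) := by
        refine tsum_congr fun h => ?_
        rw [ENNReal.tsum_comm]
        refine tsum_congr fun y => ?_
        rw [ENNReal.tsum_mul_left, ENNReal.tsum_mul_right]
    _ = ∑' h, ∑' y, gapSum L h * (openGap M h y * gapSum R y) := rfl

/-! ## The averaged double-open element and the averaged split -/

/-- **The class-averaged double-open element** (four shapes): with `g(v,y) = Σ_s M(0,v,s,s+y)`,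
`(sup, sup)`: `sup_{v,y} g` = the printed `(Ā^ι)_{a,b}` (`normOO`); `(sup, avg)`: `sup_v |U|⁻¹ Σ_{y∈U} g(v,y)`;
`(avg, sup)`: `sup_y |U|⁻¹ Σ_{v∈U} g(v,y)`; `(avg, avg)`: `|U|⁻² Σ_{v,y∈U} g(v,y)` — the notebook's class-1 entries
(`Percolation.nb` cell 69: `Bound[AiotaBar,a,1,s] = Bound[Aiota,a,1,s]/(2d z[s])`, the `1/(2d)` being the average
over the `2d` unit out-offsets; the printed element is the coarser supremum).
[cite: FitznerVanDerHofstad2017, §5.1 "Elements of the bounds" `(Ā^ι)_{a,b}` (arXiv:1506.07977v2 p. 49) and §6.1 p. 59 "When a = 1 and/or b = 1, we include the information that either u,w and/or z,t are neighbors"] -/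
def normOOavg (U : Finset G) (aIn aOut : Bool) (M : G → G → G → G → ℝ≥0∞) : ℝ≥0∞ :=
  match aIn, aOut with
  | false, false => normOO M
  | false, true => ⨆ v, avgOn U (fun y => openGap M v y)
  | true, false => ⨆ y, avgOn U (fun v => openGap M v y)
  | true, true => avgOn U (fun v => avgOn U (fun y => openGap M v y))

/-- `(sup, sup)` is the printed element. [folklore] -/
@[simp] theorem normOOavg_false_false (U : Finset G) (M : G → G → G → G → ℝ≥0∞) :
    normOOavg U false false M = normOO M := rfl

/-- `(sup, avg)`. [folklore] -/
theorem normOOavg_false_true (U : Finset G) (M : G → G → G → G → ℝ≥0∞) :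
    normOOavg U false true M = ⨆ v, avgOn U (fun y => openGap M v y) := rfl

/-- `(avg, sup)`. [folklore] -/
theorem normOOavg_true_false (U : Finset G) (M : G → G → G → G → ℝ≥0∞) :
    normOOavg U true false M = ⨆ y, avgOn U (fun v => openGap M v y) := rfl

/-- `(avg, avg)`. [folklore] -/
theorem normOOavg_true_true (U : Finset G) (M : G → G → G → G → ℝ≥0∞) :
    normOOavg U true true M = avgOn U (fun v => avgOn U (fun y => openGap M v y)) := rfl

/-- **Averaging never exceeds the printed supremum**: `normOOavg U aIn aOut M ≤ normOO M`, so every bound of the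
tree stated with the printed element follows from the averaged one. [folklore] -/
theorem normOOavg_le_normOO (U : Finset G) (aIn aOut : Bool) (M : G → G → G → G → ℝ≥0∞) :
    normOOavg U aIn aOut M ≤ normOO M := by
  cases aIn <;> cases aOut
  · exact le_rfl
  · show (⨆ v, avgOn U (fun y => openGap M v y)) ≤ ⨆ v, ⨆ y, openGap M v y
    exact iSup_mono fun v => avgOn_le_iSup U _
  · show (⨆ y, avgOn U (fun v => openGap M v y)) ≤ ⨆ v, ⨆ y, openGap M v y
    refine iSup_le fun y => (avgOn_le_iSup U _).trans (iSup_mono fun v => ?_)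
    exact le_iSup (fun y => openGap M v y) y
  · show avgOn U (fun v => avgOn U (fun y => openGap M v y)) ≤ ⨆ v, ⨆ y, openGap M v y
    exact (avgOn_le_iSup U _).trans (iSup_mono fun v => avgOn_le_iSup U _)

/-- **The split (6.5) with the AVERAGED element.**  For a translation-invariant block `M`, a left piece `L`, a right
piece `R` entering through `t − x`, `z − x`, a finite set of offsets `U`, and flags `aIn`, `aOut`:
if, on each averaged side, the block is SUPPORTED on offsets in `U` (`M(0,v,x,y) = 0` unless `v ∈ U`, resp. unless
`y − x ∈ U`) and the flanking gap aggregate is CONSTANT on `U` (`Σ_s L(s,s+v)`, resp. `Σ_s R(s,s+y)`, the same for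
all `v ∈ U` — lattice symmetry of `P^S`, `P^E` on the `2d` unit vectors), then
`Σ_x Σ_{u,w,t,z} L(u,w) M(u,w,t,z) R(t−x,z−x) ≤ λ(L) · normOOavg U aIn aOut M · λ(R)`.
[cite: FitznerVanDerHofstad2017, §6.1 (6.5) (arXiv:1506.07977v2 p. 58) with §6.1 p. 59 "we include the information that … are neighbors … improved numerical bounds"] -/
theorem junction_le_avg (U : Finset G) (aIn aOut : Bool) (L : G → G → ℝ≥0∞)
    {M : G → G → G → G → ℝ≥0∞} (hM : IsTransInv M) (R : G → G → ℝ≥0∞)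
    (hL : aIn = true → IsConstOn U (gapSum L)) (hR : aOut = true → IsConstOn U (gapSum R))
    (hMin : aIn = true → ∀ v x y, v ∉ U → M 0 v x y = 0)
    (hMout : aOut = true → ∀ v x y, y - x ∉ U → M 0 v x y = 0) :
    ∑' x, ∑' u, ∑' w, ∑' t, ∑' z, L u w * M u w t z * R (t - x) (z - x)
      ≤ pairSum L * normOOavg U aIn aOut M * pairSum R := by
  rw [junction_eq_gapSum L hM R]
  -- support of the open gap function on the averaged sides
  have gIn : aIn = true → ∀ y, ∀ v ∉ U, openGap M v y = 0 := by
    intro h y v hv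
    unfold openGap
    exact ENNReal.tsum_eq_zero.mpr fun s => hMin h v s (s + y) hv
  have gOut : aOut = true → ∀ v, ∀ y ∉ U, openGap M v y = 0 := by
    intro h v y hy
    unfold openGap
    exact ENNReal.tsum_eq_zero.mpr fun s => hMout h v s (s + y) (by rwa [add_sub_cancel_left])
  cases aIn <;> cases aOut
  · -- (sup, sup): bound the open gap function by the supremum
    show _ ≤ pairSum L * normOO M * pairSum R
    calc ∑' h, ∑' y, gapSum L h * (openGap M h y * gapSum R y)
        ≤ ∑' h, ∑' y, gapSum L h * (normOO M * gapSum R y) := by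
          refine ENNReal.tsum_le_tsum fun h => ENNReal.tsum_le_tsum fun y => ?_
          gcongr
          exact le_iSup₂ (f := fun v y => openGap M v y) h y
      _ = pairSum L * normOO M * pairSum R := by
          simp only [ENNReal.tsum_mul_left, ENNReal.tsum_mul_right, mul_assoc]
          rw [pairSum_eq_tsum_gapSum L, pairSum_eq_tsum_gapSum R]
  · -- (sup, avg): average the out-offset against the constant right flank
    show _ ≤ pairSum L * (⨆ v, avgOn U (fun y => openGap M v y)) * pairSum R
    have step : ∀ h, ∑' y, gapSum L h * (openGap M h y * gapSum R y)
        ≤ gapSum L h * ((⨆ v, avgOn U (fun y => openGap M v y)) * pairSum R) := by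
      intro h
      rw [ENNReal.tsum_mul_left]
      gcongr
      calc ∑' y, openGap M h y * gapSum R y
          = ∑' y, gapSum R y * openGap M h y := by simp only [mul_comm]
        _ = (∑ y ∈ U, gapSum R y) * avgOn U (fun y => openGap M h y) :=
            tsum_mul_eq_sum_mul_avgOn U (hR rfl) (gOut rfl h)
        _ ≤ pairSum R * ⨆ v, avgOn U (fun y => openGap M v y) :=
            mul_le_mul' (sum_gapSum_le_pairSum R U)
              (le_iSup (fun v => avgOn U (fun y => openGap M v y)) h)
        _ = (⨆ v, avgOn U (fun y => openGap M v y)) * pairSum R := mul_comm _ _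
    calc ∑' h, ∑' y, gapSum L h * (openGap M h y * gapSum R y)
        ≤ ∑' h, gapSum L h * ((⨆ v, avgOn U (fun y => openGap M v y)) * pairSum R) :=
          ENNReal.tsum_le_tsum step
      _ = pairSum L * (⨆ v, avgOn U (fun y => openGap M v y)) * pairSum R := by
          rw [ENNReal.tsum_mul_right, pairSum_eq_tsum_gapSum L, mul_assoc]
  · -- (avg, sup): average the in-offset against the constant left flank
    show _ ≤ pairSum L * (⨆ y, avgOn U (fun v => openGap M v y)) * pairSum R
    rw [ENNReal.tsum_comm]
    have step : ∀ y, ∑' h, gapSum L h * (openGap M h y * gapSum R y)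
        ≤ pairSum L * (⨆ y, avgOn U (fun v => openGap M v y)) * gapSum R y := by
      intro y
      calc ∑' h, gapSum L h * (openGap M h y * gapSum R y)
          = (∑' h, gapSum L h * openGap M h y) * gapSum R y := by
            simp only [← mul_assoc, ENNReal.tsum_mul_right]
        _ = (∑ h ∈ U, gapSum L h) * avgOn U (fun v => openGap M v y) * gapSum R y := by
            rw [tsum_mul_eq_sum_mul_avgOn U (hL rfl) (fun v hv => gIn rfl y v hv)]
        _ ≤ pairSum L * (⨆ y, avgOn U (fun v => openGap M v y)) * gapSum R y :=
            mul_le_mul' (mul_le_mul' (sum_gapSum_le_pairSum L U)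
              (le_iSup (fun y => avgOn U (fun v => openGap M v y)) y)) le_rfl
    calc ∑' y, ∑' h, gapSum L h * (openGap M h y * gapSum R y)
        ≤ ∑' y, pairSum L * (⨆ y, avgOn U (fun v => openGap M v y)) * gapSum R y :=
          ENNReal.tsum_le_tsum step
      _ = pairSum L * (⨆ y, avgOn U (fun v => openGap M v y)) * pairSum R := by
          rw [ENNReal.tsum_mul_left, pairSum_eq_tsum_gapSum R]
  · -- (avg, avg): both flanks
    show _ ≤ pairSum L * avgOn U (fun v => avgOn U (fun y => openGap M v y)) * pairSum R
    have inner : ∀ h, ∑' y, gapSum L h * (openGap M h y * gapSum R y)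
        = gapSum L h * avgOn U (fun y => openGap M h y) * ∑ y ∈ U, gapSum R y := by
      intro h
      rw [ENNReal.tsum_mul_left]
      have e : ∑' y, openGap M h y * gapSum R y
          = (∑ y ∈ U, gapSum R y) * avgOn U (fun y => openGap M h y) := by
        calc ∑' y, openGap M h y * gapSum R y
            = ∑' y, gapSum R y * openGap M h y := by simp only [mul_comm]
          _ = _ := tsum_mul_eq_sum_mul_avgOn U (hR rfl) (gOut rfl h)
      rw [e]
      ring
    have suppA : ∀ h ∉ U, avgOn U (fun y => openGap M h y) = 0 :=
      fun h hh => avgOn_eq_zero U fun y _ => gIn rfl y h hh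
    calc ∑' h, ∑' y, gapSum L h * (openGap M h y * gapSum R y)
        = ∑' h, gapSum L h * avgOn U (fun y => openGap M h y) * ∑ y ∈ U, gapSum R y :=
          tsum_congr inner
      _ = (∑' h, gapSum L h * avgOn U (fun y => openGap M h y)) * ∑ y ∈ U, gapSum R y :=
          ENNReal.tsum_mul_right
      _ = (∑ h ∈ U, gapSum L h) * avgOn U (fun v => avgOn U (fun y => openGap M v y))
            * ∑ y ∈ U, gapSum R y := by
          rw [tsum_mul_eq_sum_mul_avgOn U (hL rfl) suppA]
      _ ≤ pairSum L * avgOn U (fun v => avgOn U (fun y => openGap M v y)) * pairSum R :=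
          mul_le_mul' (mul_le_mul' (sum_gapSum_le_pairSum L U) le_rfl) (sum_gapSum_le_pairSum R U)

end Gap

/-! ## Matrix forms: the averaged `Ā`-element in the bounds (6.5), (5.34), (5.37) -/

section MatrixAvg

variable {G ι K : Type*} [AddCommGroup G]

/-- The AVERAGED double-open matrix: entry `(a,b)` is `normOOavg U (avg a) (avg b)` of the `κ`-summed block — the
notebook's `Ā^ι`-type elements (class `1` averaged over the `2d` unit offsets, the other classes supremised as
printed). [cite: FitznerVanDerHofstad2017, §5.1 "Elements of the bounds" `(Ā^ι)_{a,b}` (arXiv:1506.07977v2 p. 49) with §6.1 p. 59] -/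
def matAbarAvg [Fintype K] (U : Finset G) (avg : ι → Bool)
    (A : K → ι → ι → G → G → G → G → ℝ≥0∞) : Matrix ι ι ℝ≥0∞ :=
  Matrix.of fun a b => normOOavg U (avg a) (avg b) (fun u v x y => ∑ κ, A κ a b u v x y)

/-- Entries of `matAbarAvg`. [folklore] -/
theorem matAbarAvg_apply [Fintype K] (U : Finset G) (avg : ι → Bool)
    (A : K → ι → ι → G → G → G → G → ℝ≥0∞) (a b : ι) :
    matAbarAvg U avg A a b = normOOavg U (avg a) (avg b) (fun u v x y => ∑ κ, A κ a b u v x y) := rfl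

/-- **Averaged ≤ printed, entrywise**: `matAbarAvg U avg A a b ≤ matAbar A a b`. [folklore] -/
theorem matAbarAvg_le_matAbar [Fintype K] (U : Finset G) (avg : ι → Bool)
    (A : K → ι → ι → G → G → G → G → ℝ≥0∞) (a b : ι) :
    matAbarAvg U avg A a b ≤ matAbar A a b :=
  normOOavg_le_normOO U (avg a) (avg b) _

/-- **[FvdH17] (6.5) with the averaged element, exit arguments ordered as in (6.4)** (`P^{E,b}(t − x, z − x)`):
if `Ξ(x) ≤ Σ_{u,w,t,z} Σ_κ Σ_{a,b} L^a(u,w) Ā^{κ,a,b}(u,w,t,z) E^b(t−x, z−x)` for every `x`, the blocks are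
translation invariant, the `κ`-summed blocks of an averaged in-class (out-class) are supported on in-offsets
(out-offsets) in `U`, and the left (right) pieces of the averaged classes have gap aggregates constant on `U`, then
`Σ_x Ξ(x) ≤ Σ_{a,b} (L⃗)_a (Ā_avg)_{a,b} (E⃗)_b`.
[cite: FitznerVanDerHofstad2017, §6.1 (6.4)–(6.5) (arXiv:1506.07977v2 p. 58); §5.1 p. 49; §6.1 p. 59] -/
theorem tsum_le_of_xSpaceBound_avg' [Fintype ι] [Fintype K] (U : Finset G) (avg : ι → Bool)
    {A : K → ι → ι → G → G → G → G → ℝ≥0∞} (hA : ∀ κ a b, IsTransInv (A κ a b))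
    (hAin : ∀ κ a b, avg a = true → ∀ v x y, v ∉ U → A κ a b 0 v x y = 0)
    (hAout : ∀ κ a b, avg b = true → ∀ v x y, y - x ∉ U → A κ a b 0 v x y = 0)
    (Ξ : G → ℝ≥0∞) (L E : ι → G → G → ℝ≥0∞)
    (hL : ∀ a, avg a = true → IsConstOn U (gapSum (L a)))
    (hE : ∀ b, avg b = true → IsConstOn U (gapSum (E b)))
    (hΞ : ∀ x, Ξ x ≤ ∑' u, ∑' w, ∑' t, ∑' z, ∑ κ, ∑ a, ∑ b,
      L a u w * A κ a b u w t z * E b (t - x) (z - x)) :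
    ∑' x, Ξ x ≤ ∑ a, ∑ b, vecP L a * matAbarAvg U avg A a b * vecP E b := by
  calc ∑' x, Ξ x
      ≤ ∑' x, ∑' u, ∑' w, ∑' t, ∑' z, ∑ κ, ∑ a, ∑ b, L a u w * A κ a b u w t z * E b (t - x) (z - x) :=
        ENNReal.tsum_le_tsum hΞ
    _ = ∑' x, ∑' u, ∑' w, ∑' t, ∑' z, ∑ a, ∑ b,
          L a u w * (∑ κ, A κ a b u w t z) * E b (t - x) (z - x) := by
        simp only [sum_sum_sum_mul_mul]
    _ = ∑ a, ∑ b, ∑' x, ∑' u, ∑' w, ∑' t, ∑' z,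
          L a u w * (∑ κ, A κ a b u w t z) * E b (t - x) (z - x) := by
        simp only [tsum_finsetSum]
    _ ≤ ∑ a, ∑ b, vecP L a * matAbarAvg U avg A a b * vecP E b :=
        Finset.sum_le_sum fun a _ => Finset.sum_le_sum fun b _ =>
          junction_le_avg U (avg a) (avg b) (L a) (IsTransInv.finsetSum Finset.univ fun κ _ => hA κ a b)
            (E b) (hL a) (hE b)
            (fun h v x y hv => Finset.sum_eq_zero fun κ _ => hAin κ a b h v x y hv)
            (fun h v x y hy => Finset.sum_eq_zero fun κ _ => hAout κ a b h v x y hy)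

/-- The same with the exit arguments ordered as in Lemma 6.1 (6.51) (`R^{(0),b}(z − x, t − x)`); here `U` must be
symmetric (`−U = U`, true for the unit vectors), because the right flank then enters through `Σ_s E^b(s+y, s)`.
[cite: FitznerVanDerHofstad2017, Lemma 6.1 (6.51) (arXiv:1506.07977v2 p. 66); §6.1 (6.5) (p. 58)] -/
theorem tsum_le_of_xSpaceBound_avg [Fintype ι] [Fintype K] (U : Finset G) (hUneg : ∀ v ∈ U, -v ∈ U)
    (avg : ι → Bool)
    {A : K → ι → ι → G → G → G → G → ℝ≥0∞} (hA : ∀ κ a b, IsTransInv (A κ a b))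
    (hAin : ∀ κ a b, avg a = true → ∀ v x y, v ∉ U → A κ a b 0 v x y = 0)
    (hAout : ∀ κ a b, avg b = true → ∀ v x y, y - x ∉ U → A κ a b 0 v x y = 0)
    (Ξ : G → ℝ≥0∞) (L E : ι → G → G → ℝ≥0∞)
    (hL : ∀ a, avg a = true → IsConstOn U (gapSum (L a)))
    (hE : ∀ b, avg b = true → IsConstOn U (gapSum (E b)))
    (hΞ : ∀ x, Ξ x ≤ ∑' u, ∑' w, ∑' t, ∑' z, ∑ κ, ∑ a, ∑ b,
      L a u w * A κ a b u w t z * E b (z - x) (t - x)) :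
    ∑' x, Ξ x ≤ ∑ a, ∑ b, vecP L a * matAbarAvg U avg A a b * vecP E b := by
  have hE' : ∀ b, avg b = true → IsConstOn U (gapSum (fun p q => E b q p)) := by
    intro b hb v hv v' hv'
    rw [gapSum_swap (E b) v, gapSum_swap (E b) v']
    exact hE b hb (hUneg v hv) (hUneg v' hv')
  have h := tsum_le_of_xSpaceBound_avg' U avg hA hAin hAout Ξ L (fun b p q => E b q p) hL hE' hΞ
  simpa only [vecP, pairSum_swap] using h

/-- Row vector × averaged matrix × column vector form of `tsum_le_of_xSpaceBound_avg'` (the `N = 1` bound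
`Σ_x Ξ^{(1)}(x) ≤ P⃗^S Ā^ι P⃗^E` of (6.5) / the first displays of Lemmas 5.2 and 5.3, with the averaged `Ā^ι`).
[cite: FitznerVanDerHofstad2017, §6.1 (6.5) (arXiv:1506.07977v2 p. 58); Lemma 5.2 / 5.3 first displays (p. 50)] -/
theorem tsum_le_vecMul_matAbarAvg_dotProduct' [Fintype ι] [Fintype K] (U : Finset G) (avg : ι → Bool)
    {A : K → ι → ι → G → G → G → G → ℝ≥0∞} (hA : ∀ κ a b, IsTransInv (A κ a b))
    (hAin : ∀ κ a b, avg a = true → ∀ v x y, v ∉ U → A κ a b 0 v x y = 0)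
    (hAout : ∀ κ a b, avg b = true → ∀ v x y, y - x ∉ U → A κ a b 0 v x y = 0)
    (Ξ : G → ℝ≥0∞) (L E : ι → G → G → ℝ≥0∞)
    (hL : ∀ a, avg a = true → IsConstOn U (gapSum (L a)))
    (hE : ∀ b, avg b = true → IsConstOn U (gapSum (E b)))
    (hΞ : ∀ x, Ξ x ≤ ∑' u, ∑' w, ∑' t, ∑' z, ∑ κ, ∑ a, ∑ b,
      L a u w * A κ a b u w t z * E b (t - x) (z - x)) :
    ∑' x, Ξ x ≤ vecP L ᵥ* matAbarAvg U avg A ⬝ᵥ vecP E := by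
  rw [← sum_sum_mul_mul_eq_vecMul_dotProduct]
  exact tsum_le_of_xSpaceBound_avg' U avg hA hAin hAout Ξ L E hL hE hΞ

/-- **[FvdH17] (5.34)/(5.37) with the averaged terminal element, PROVED in abstract form**: if `Ξ` obeys the
`x`-space bound of Lemma 6.1 (6.51) with the recursively built left piece `P^{(M)}` of (6.48)–(6.49), translation
invariant blocks, the right piece `P^E`, and the support / flank-constancy hypotheses of the averaged classes (the
left flank being `P^{(M)}` itself — see `isConstOn_gapSum_recP` for how covariance of `P^S` and of the closed blocks
delivers it), then `Σ_x Ξ(x) ≤ P⃗S B^M Ā_avg P⃗E`.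
[cite: FitznerVanDerHofstad2017, Prop. 5.5 (5.34) and Prop. 5.6 (5.37) (arXiv:1506.07977v2 p. 53); proof §6.2.1 (pp. 65–67); §6.1 p. 59] -/
theorem tsum_le_vecMul_pow_dotProduct_avg [Fintype ι] [DecidableEq ι] [Fintype K] (U : Finset G)
    (hUneg : ∀ v ∈ U, -v ∈ U) (avg : ι → Bool)
    {B A : K → ι → ι → G → G → G → G → ℝ≥0∞} (hB : ∀ κ a b, IsTransInv (B κ a b))
    (hA : ∀ κ a b, IsTransInv (A κ a b))
    (hAin : ∀ κ a b, avg a = true → ∀ v x y, v ∉ U → A κ a b 0 v x y = 0)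
    (hAout : ∀ κ a b, avg b = true → ∀ v x y, y - x ∉ U → A κ a b 0 v x y = 0)
    (Ξ : G → ℝ≥0∞) (PS PE : ι → G → G → ℝ≥0∞) (M : ℕ)
    (hPM : ∀ a, avg a = true → IsConstOn U (gapSum (recP PS B M a)))
    (hPE : ∀ b, avg b = true → IsConstOn U (gapSum (PE b)))
    (hΞ : ∀ x, Ξ x ≤ ∑' u, ∑' w, ∑' t, ∑' z, ∑ κ, ∑ a, ∑ b,
      recP PS B M a u w * A κ a b u w t z * PE b (z - x) (t - x)) :
    ∑' x, Ξ x ≤ vecP PS ᵥ* matB B ^ M ᵥ* matAbarAvg U avg A ⬝ᵥ vecP PE := by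
  calc ∑' x, Ξ x
      ≤ ∑ a, ∑ b, vecP (recP PS B M) a * matAbarAvg U avg A a b * vecP PE b :=
        tsum_le_of_xSpaceBound_avg U hUneg avg hA hAin hAout Ξ _ PE hPM hPE hΞ
    _ ≤ ∑ a, ∑ b, (vecP PS ᵥ* matB B ^ M) a * matAbarAvg U avg A a b * vecP PE b :=
        Finset.sum_le_sum fun a _ => Finset.sum_le_sum fun b _ =>
          mul_le_mul' (mul_le_mul' (vecP_recP_le_vecMul_pow hB PS M a) le_rfl) le_rfl
    _ = vecP PS ᵥ* matB B ^ M ᵥ* matAbarAvg U avg A ⬝ᵥ vecP PE :=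
        sum_sum_mul_mul_eq_vecMul_dotProduct _ _ _

end MatrixAvg

/-! ## The covariance bridge: lattice symmetry ⇒ flank constancy -/

section Covariance

variable {G ι K : Type*} [AddCommGroup G]

/-- Covariance of a two-point piece under a set `Φ` of additive automorphisms (in the paper: the signed permutations
of `ℤ^d`, under which `P^{S,b}`, `P^{E,b}` are invariant). [folklore] -/
def IsCov₂ (Φ : Set (G ≃+ G)) (L : G → G → ℝ≥0∞) : Prop :=
  ∀ φ ∈ Φ, ∀ u w, L (φ u) (φ w) = L u w

/-- Covariance of a four-point block under `Φ` (asked of the `κ`-SUMMED blocks `Σ_κ B^{κ,a,b}`; a single `B^{κ,a,b}`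
is not covariant, `κ` being a direction). [folklore] -/
def IsCov₄ (Φ : Set (G ≃+ G)) (M : G → G → G → G → ℝ≥0∞) : Prop :=
  ∀ φ ∈ Φ, ∀ u v x y, M (φ u) (φ v) (φ x) (φ y) = M u v x y

/-- A covariant piece has a covariant gap aggregate: `Λ_L(φ v) = Λ_L(v)`. [folklore] -/
theorem gapSum_addEquiv (φ : G ≃+ G) {L : G → G → ℝ≥0∞} (hL : ∀ u w, L (φ u) (φ w) = L u w) (v : G) :
    gapSum L (φ v) = gapSum L v := by
  unfold gapSum
  calc ∑' s, L s (s + φ v)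
      = ∑' s, L (φ s) (φ s + φ v) := (Equiv.tsum_eq φ.toEquiv (fun s => L s (s + φ v))).symm
    _ = ∑' s, L s (s + v) := tsum_congr fun s => by rw [← map_add]; exact hL s (s + v)

/-- **Transitivity + covariance ⇒ orbit constancy**: if `Φ` maps any point of `U` to any other and `L` is
`Φ`-covariant, then `Λ_L` is constant on `U` (for `P^{E,1}`: `Σ_x P^{E,1}(x, x+u)` is the same for all unit `u`).
[folklore] -/
theorem isConstOn_gapSum_of_cov (Φ : Set (G ≃+ G)) (U : Finset G)
    (hT : ∀ v ∈ U, ∀ v' ∈ U, ∃ φ ∈ Φ, φ v = v') {L : G → G → ℝ≥0∞} (hL : IsCov₂ Φ L) :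
    IsConstOn U (gapSum L) := by
  intro v hv v' hv'
  obtain ⟨φ, hφ, rfl⟩ := hT v hv v' hv'
  exact (gapSum_addEquiv φ (hL φ hφ) v).symm

/-- **The recursively built left pieces stay covariant**: if every `P^{S,a}` is `Φ`-covariant and every `κ`-summed
closed block `Σ_κ B^{κ,a,b}` is `Φ`-covariant, then every `P^{(N),a}` of (6.48)–(6.49) is `Φ`-covariant.
[cite: FitznerVanDerHofstad2017, §6.2.1 (6.48)–(6.49) (arXiv:1506.07977v2 p. 65)] -/
theorem isCov₂_recP [Fintype ι] [Fintype K] (Φ : Set (G ≃+ G)) (PS : ι → G → G → ℝ≥0∞)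
    (hPS : ∀ a, IsCov₂ Φ (PS a)) (B : K → ι → ι → G → G → G → G → ℝ≥0∞)
    (hB : ∀ a b, IsCov₄ Φ (fun u v x y => ∑ κ, B κ a b u v x y)) :
    ∀ (N : ℕ) (a : ι), IsCov₂ Φ (recP PS B N a)
  | 0, a => hPS a
  | N + 1, b => by
      intro φ hφ u w
      have inner : ∀ (p q : G) (u' w' : G), (∑ κ, ∑ a, recP PS B N a u' w' * B κ a b u' w' p q)
          = ∑ a, recP PS B N a u' w' * ∑ κ, B κ a b u' w' p q := by
        intro p q u' w'
        rw [Finset.sum_comm]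
        simp only [Finset.mul_sum]
      simp only [recP_succ, inner]
      calc ∑' u', ∑' w', ∑ a, recP PS B N a u' w' * ∑ κ, B κ a b u' w' (φ w) (φ u)
          = ∑' u', ∑' w', ∑ a, recP PS B N a (φ u') (φ w') * ∑ κ, B κ a b (φ u') (φ w') (φ w) (φ u) := by
            calc ∑' u', ∑' w', ∑ a, recP PS B N a u' w' * ∑ κ, B κ a b u' w' (φ w) (φ u)
                = ∑' u', ∑' w', ∑ a, recP PS B N a (φ u') w' * ∑ κ, B κ a b (φ u') w' (φ w) (φ u) :=
                  (Equiv.tsum_eq φ.toEquiv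
                    (fun u' => ∑' w', ∑ a, recP PS B N a u' w' * ∑ κ, B κ a b u' w' (φ w) (φ u))).symm
              _ = _ := tsum_congr fun u' => (Equiv.tsum_eq φ.toEquiv
                    (fun w' => ∑ a, recP PS B N a (φ u') w' * ∑ κ, B κ a b (φ u') w' (φ w) (φ u))).symm
        _ = ∑' u', ∑' w', ∑ a, recP PS B N a u' w' * ∑ κ, B κ a b u' w' w u := by
            refine tsum_congr fun u' => tsum_congr fun w' => Finset.sum_congr rfl fun a _ => ?_
            have hB' : ∑ κ, B κ a b (φ u') (φ w') (φ w) (φ u) = ∑ κ, B κ a b u' w' w u :=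
              hB a b φ hφ u' w' w u
            rw [isCov₂_recP Φ PS hPS B hB N a φ hφ u' w', hB']

/-- Hence the left flank of every chain qualifies for `junction_le_avg` / `tsum_le_vecMul_pow_dotProduct_avg`:
under transitivity of `Φ` on `U`, covariance of `P^S` and of the `κ`-summed closed blocks, the gap aggregate of
`P^{(N),a}` is constant on `U` for every `N` and `a`. [cite: FitznerVanDerHofstad2017, §6.2.1 (6.48)–(6.49) (arXiv:1506.07977v2 p. 65); §6.1 p. 59] -/
theorem isConstOn_gapSum_recP [Fintype ι] [Fintype K] (Φ : Set (G ≃+ G)) (U : Finset G)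
    (hT : ∀ v ∈ U, ∀ v' ∈ U, ∃ φ ∈ Φ, φ v = v') (PS : ι → G → G → ℝ≥0∞)
    (hPS : ∀ a, IsCov₂ Φ (PS a)) (B : K → ι → ι → G → G → G → G → ℝ≥0∞)
    (hB : ∀ a b, IsCov₄ Φ (fun u v x y => ∑ κ, B κ a b u v x y)) (N : ℕ) (a : ι) :
    IsConstOn U (gapSum (recP PS B N a)) :=
  isConstOn_gapSum_of_cov Φ U hT (isCov₂_recP Φ PS hPS B hB N a)

end Covariance

end Literature.Probability.FitznerVanDerHofstad2017.BlockSummation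

end
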